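import Summits.HodgeConjecture.HodgeConjecture.Theorems.VHCAbelianSchemesRoadDiagonalCM
import Summits.HodgeConjecture.HodgeConjecture.Theses.VHCAbelianSchemesRoad
import Literature.AlgebraicGeometry.Motives.CurveThroughTwoPointsNonSeparated
import HarnessLib

/-!
# Road b02 (`VHCAbelianSchemesRoad`, D-0059) — ONE CELL PER CLASS: VHC at `(n, p)` on every abelian scheme with a section consumes the
# crux on the SINGLE diagonal cell `(2m, m)`, `m = max(p, n − p)`; hence `HCAtDim g` from the window `g + 2 ≤ m ≤ 2g − 2` and
# `HC_AV` from `HC_CM` + the diagonal `m ≥ 6` with NO low-dimensional input (resp. `m ≥ 8` mod Markman ≤ 5)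

research route, not a corollary; conditional on HC_CM plus one named minimal statement.
(cell line: research route conditional on HC_CM; not a corollary; Q11.4-sentence-2 already refuted in dim ≥ 3.)

THEOREMS ONLY (no definition, no named fact, no sorry; `HC_CM` = `Theses.RankFourFaces.CMAbelianHodge` or its dimension slice is an
explicit HYPOTHESIS of §§3–4; nothing of the road's research content is claimed). Seat ab-andre-2 gen 55, PART X-d — the sharpening of
`VHCAbelianSchemesRoadDiagonalCM.lean` (p449674) announced in its header («a reduction graded by `(n, p)` would shrink the window to
`g + 2 ≤ m ≤ 2g − 2`»): the curve reduction is done per CLASS, not per family, using the tree THEOREM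
`mumford_smoothCurve_through_two_points_of_irreducibleSpace_of_smooth` (any two complex points of a smooth irreducible `ℂ`-scheme lie on
the image of a smooth irreducible AFFINE CURVE) and the AnchorTransport base-change transport `Theorems.variationalHodge_conclusion_of_baseChange`:
* §1 per pencil, ONE cell: on a one-parameter abelian scheme of relative dimension `n` the conclusion of node (U) for a class of mid-range
  codimension `p` follows from the door and the graded crux at the single cell `(2(n − p), n − p)` if `2p ≤ n` (padding), `(2p, p)` if
  `2p ≥ n` (shadow, then padding) — i.e. `(2m, m)` with `m = max(p, n − p)`; hence VHC on every fibre of such a pencil (thick sets).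
* §2 per class over any base with a section: the VHC conclusion at `(n, p)` from the same single cell, the door and the curve residual —
  join anchor and target by an affine curve, base-change (sections pull back, fibres are fibres), apply §1 on the curve.
* §3 per abelian variety `A` of dimension `g`: `HodgeConjectureFor A` from Lemme 6.3.1, `HC_CM` at dimension `2g`, the door, the residual
  and the crux on the cells `(2m, m)`, `g + 2 ≤ m ≤ 2g − 2` (André's class has codimension `2 ≤ p ≤ g − 2` on the pencil of relative
  dimension `2g`, so `m = 2g − p`); e.g. abelian SIXFOLDS: `HC_CM` for 12-folds and the cells `(16,8), (18,9), (20,10)`.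
* §4 rows: `HCAtDim g` from that window; **`HC_AV` from `HC_CM`, Lemme 6.3.1, the door, the residual and the diagonal cells `m ≥ 6` —
  with NO low-dimensional input** (`g ≤ 3`: `hcAtDim_of_le_three`; `g ≥ 4`: `m ≥ g + 2 ≥ 6`): part X-b's `m ≥ 6` row FREED of the
  unrefereed Markman claim; and `m ≥ 8` granted `HCUpToDim 5`; the twisted-door `closes`-shapes with route-decl hypotheses.

NOT claimed: any cell of the crux; `HC_CM`; a converse. HONEST NOTE: under `HC_CM` the road's carriers are consumed on pencils of
relative dimension `≥ 12` only (`2m`, `m ≥ 6`) — André's reduction trades the dimension of the pencil (`2·dim A`, padded) for the CM anchor.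

References: [MumfordAV1970] §6 Lemma; [Andre1996Motifs] Lemme 6.3.1 (p. 31), §6.3 a) (p. 33); [Abdulali1994FamiliesAV] Lemma 6.2;
[BrosnanFangNiePearlstein2009] §6 Lemma 48; [Lieberman1968]; [CharlesSchnell2014Notes] Prop. 11.3.11 (proof); [BuchweitzFlenner2003] §5
Thm. 5.1; [Markman2025SurveySecant] Cor. 1.3; [GortzWedhorn2023] Thm. 27.291; [Milne1999] §7.
-/

noncomputable section

open CategoryTheory CategoryTheory.Limits AlgebraicGeometry Topology MonoidalCategory CartesianMonoidalCategory

namespace Summit.HodgeConjecture.HodgeConjecture.Ring2.SemiregularRepresentatives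

set_option linter.dupNamespace false -- the cell's namespace repeats the summit name, as in every `Ring2*` file

open Literature.AlgebraicGeometry Literature.AlgebraicGeometry.Motives Literature.AlgebraicGeometry.HodgeTheory
open Literature.AlgebraicTopology.SingularHomology
open Literature.AlgebraicGeometry.Andre1996 (andre1996_cmAnchoredPencil compactPencil_dim_eq_of_iso
  compactPencil_irreducibleSpace_base compactPencil_smooth_base compactPencil_exists_abelianVariety_fiber_dim)
open Literature.AlgebraicGeometry.Milne1999 (CMHodgeHypothesisAt)
open Summit.Ventures.HSemireg (ObjClass LocalVariationalHodgeFor)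
open Summit.HodgeConjecture.HodgeConjecture.Ring2.Binders
open Summit.HodgeConjecture.HodgeConjecture.Ring2.ClassTargets

variable {𝒳 S : SchemeOver ℂ}

/-! ## §1 One cell per class, per pencil -/

/-- **(U)'s conclusion at `(n, p)`, `2 ≤ p`, `2p ≤ n`, from the SINGLE cell `(2(n − p), n − p)`** (the pencil itself if `2p = n`, else
the padded pencil `𝒳 × B`, `dim B = n − 2p`). [cite: BrosnanFangNiePearlstein2009, §6 Lemma 48] [cite: BuchweitzFlenner2003, §5 Thm. 5.1] -/
theorem not_countable_algebraicityLocus_of_cell_of_lowerHalf {𝒪 : ObjClass} (hT : LocalVariationalHodgeFor 𝒪) {n p : ℕ}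
    (hSR : AdmissibleRepresentativesLefAtDeg 𝒪 (2 * (n - p)) (n - p))
    (f : 𝒳 ⟶ S) (hf : IsSmoothProjectiveFamily f n) (h𝒳 : IsQuasiProjectiveOver 𝒳)
    [IrreducibleSpace S.left] [IsAffine S.left] [AlgebraicGeometry.Smooth S.hom] (hdim : topologicalKrullDim S.left = 1)
    (habel : ∀ s : ComplexPoints S, ∃ A' : AbelianVariety ℂ, A'.dim = n ∧ Nonempty (A'.X ≅ fiberOver f s))
    (he : ∃ e : S ⟶ 𝒳, e ≫ f = 𝟙 S) (hpn : 2 * p ≤ n) (W : complexBetti 𝒳 (2 * p))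
    (hW : ∀ s : ComplexPoints S, IsRationalClass (complexBetti.map (fiberι f s) (2 * p) W) ∧
      IsOfHodgeType n (fiberOver f s) (2 * p) p p (complexBetti.map (fiberι f s) (2 * p) W))
    {s₀ : ComplexPoints S} (hs₀ : complexBetti.map (fiberι f s₀) (2 * p) W ∈ algebraicClasses (fiberOver f s₀) p) :
    ¬ {s : ComplexPoints S |
        complexBetti.map (fiberι f s) (2 * p) W ∈ algebraicClasses (fiberOver f s) p}.Countable := by
  haveI : LocallyOfFiniteType S.hom := inferInstance
  haveI : IsSeparated S.hom := (IsQuasiProjectiveOver.of_isAffine S).isSeparated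
  rcases Nat.eq_or_lt_of_le hpn with hmid | hlt
  · subst hmid
    have hp : 2 * p - p = p := by omega
    rw [hp] at hSR
    exact not_countable_algebraicityLocus_of_lefAtDeg hT hSR f hf h𝒳 hdim habel he W hW hs₀
  · obtain ⟨B, hB⟩ := exists_abelianVariety_dim_eq_succ ℂ (n - 2 * p - 1)
    have hpB : 2 * p + B.dim = n := by omega
    obtain ⟨hf', habel', W', hW', hiff⟩ := exists_middleLift f hf h𝒳 habel B hpB W hW
    have hmid : n + B.dim = 2 * (p + B.dim) := by omega
    have hcell : n - p = p + B.dim := by omega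
    rw [hmid] at hf' habel' hW'
    rw [hcell] at hSR
    have h := not_countable_algebraicityLocus_of_lefAtDeg hT hSR (fst 𝒳 B.X ≫ f) hf'
      (isQuasiProjectiveOver_tensor h𝒳 (AbelianVariety.isSmoothProjective_holds (A := B)).isProjectiveOver) hdim habel'
      (exists_section_fst_comp f he B) W' hW' ((hiff s₀).2 hs₀)
    have hset : {s : ComplexPoints S | complexBetti.map (fiberι (fst 𝒳 B.X ≫ f) s) (2 * (p + B.dim)) W' ∈
          algebraicClasses (fiberOver (fst 𝒳 B.X ≫ f) s) (p + B.dim)} =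
        {s : ComplexPoints S | complexBetti.map (fiberι f s) (2 * p) W ∈ algebraicClasses (fiberOver f s) p} :=
      Set.ext fun s => hiff s
    rwa [hset] at h

/-- **(U)'s conclusion at a mid-range `(n, p)` from the SINGLE cell `(2m, m)`, `m = max(p, n − p)`** (above the middle: the shadow of
codimension `n − p` first, whose cell is `(2p, p)`). [cite: KerrPearlstein2011, §3.1] [cite: Lieberman1968, main theorem]
[cite: BrosnanFangNiePearlstein2009, §6 Lemma 48] -/
theorem not_countable_algebraicityLocus_of_cell {𝒪 : ObjClass} (hT : LocalVariationalHodgeFor 𝒪) {n p : ℕ}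
    (hSR : AdmissibleRepresentativesLefAtDeg 𝒪 (2 * max p (n - p)) (max p (n - p)))
    (f : 𝒳 ⟶ S) (hf : IsSmoothProjectiveFamily f n) (h𝒳 : IsQuasiProjectiveOver 𝒳)
    [IrreducibleSpace S.left] [IsAffine S.left] [AlgebraicGeometry.Smooth S.hom] (hdim : topologicalKrullDim S.left = 1)
    (habel : ∀ s : ComplexPoints S, ∃ A' : AbelianVariety ℂ, A'.dim = n ∧ Nonempty (A'.X ≅ fiberOver f s))
    (he : ∃ e : S ⟶ 𝒳, e ≫ f = 𝟙 S) (hpn : p ≤ n) (W : complexBetti 𝒳 (2 * p))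
    (hW : ∀ s : ComplexPoints S, IsRationalClass (complexBetti.map (fiberι f s) (2 * p) W) ∧
      IsOfHodgeType n (fiberOver f s) (2 * p) p p (complexBetti.map (fiberι f s) (2 * p) W))
    {s₀ : ComplexPoints S} (hs₀ : complexBetti.map (fiberι f s₀) (2 * p) W ∈ algebraicClasses (fiberOver f s₀) p) :
    ¬ {s : ComplexPoints S |
        complexBetti.map (fiberι f s) (2 * p) W ∈ algebraicClasses (fiberOver f s) p}.Countable := by
  haveI : LocallyOfFiniteType S.hom := inferInstance
  by_cases hpn' : 2 * p ≤ n
  · have hm : max p (n - p) = n - p := max_eq_right (by omega)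
    rw [hm] at hSR
    exact not_countable_algebraicityLocus_of_cell_of_lowerHalf hT hSR f hf h𝒳 hdim habel he hpn' W hW hs₀
  · obtain ⟨q, j, hqj, hp⟩ : ∃ q j : ℕ, 2 * q + j = n ∧ q + j = p := ⟨n - p, 2 * p - n, by omega, by omega⟩
    subst hp
    have hm : max (q + j) (n - (q + j)) = n - q := by omega
    rw [hm] at hSR
    obtain ⟨W', hW', hiff⟩ := exists_lowerShadow f hf h𝒳 (IsQuasiProjectiveOver.of_isAffine S) ‹_› habel hqj W hW
    have h := not_countable_algebraicityLocus_of_cell_of_lowerHalf hT hSR f hf h𝒳 hdim habel he (p := q) (by omega) W' hW'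
      ((hiff s₀).2 hs₀)
    have hset : {s : ComplexPoints S | complexBetti.map (fiberι f s) (2 * q) W' ∈ algebraicClasses (fiberOver f s) q} =
        {s : ComplexPoints S | complexBetti.map (fiberι f s) (2 * (q + j)) W ∈
          algebraicClasses (fiberOver f s) (q + j)} :=
      Set.ext fun s => hiff s
    rwa [hset] at h

/-- **VHC on every fibre of a one-parameter abelian scheme at `(n, p)` from the door and the single cell `(2m, m)`, `m = max(p, n − p)`**
(off the middle range no cell is needed: divisorial fibres; `p > n`: zero). [cite: CharlesSchnell2014Notes, Prop. 11.3.11 (proof)]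
[cite: VoisinHodgeI2002, Thm. 11.30] [cite: BrosnanFangNiePearlstein2009, §6 Lemma 48] -/
theorem forall_mem_algebraicClasses_oneParameter_of_cell {𝒪 : ObjClass} (hT : LocalVariationalHodgeFor 𝒪) {n p : ℕ}
    (hSR : 2 ≤ p → p + 2 ≤ n → AdmissibleRepresentativesLefAtDeg 𝒪 (2 * max p (n - p)) (max p (n - p)))
    (f : 𝒳 ⟶ S) (hf : IsSmoothProjectiveFamily f n) (h𝒳 : IsQuasiProjectiveOver 𝒳)
    [IrreducibleSpace S.left] [IsAffine S.left] [AlgebraicGeometry.Smooth S.hom] (hdim : topologicalKrullDim S.left = 1)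
    (habel : ∀ s : ComplexPoints S, ∃ A' : AbelianVariety ℂ, A'.dim = n ∧ Nonempty (A'.X ≅ fiberOver f s))
    (he : ∃ e : S ⟶ 𝒳, e ≫ f = 𝟙 S) (W : complexBetti 𝒳 (2 * p))
    (hW : ∀ s : ComplexPoints S, IsRationalClass (complexBetti.map (fiberι f s) (2 * p) W) ∧
      IsOfHodgeType n (fiberOver f s) (2 * p) p p (complexBetti.map (fiberι f s) (2 * p) W))
    {s₀ : ComplexPoints S} (hs₀ : complexBetti.map (fiberι f s₀) (2 * p) W ∈ algebraicClasses (fiberOver f s₀) p)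
    (s : ComplexPoints S) : complexBetti.map (fiberι f s) (2 * p) W ∈ algebraicClasses (fiberOver f s) p := by
  haveI : LocallyOfFiniteType S.hom := inferInstance
  by_cases hoff : p ≤ 1 ∨ n ≤ p + 1
  · exact (mem_algebraicClasses_and_divisorClassesSpan_of_offMidRange (hf.isSmoothProjective s) hoff _ (hW s).1 (hW s).2).1
  · exact Theorems.mem_algebraicClasses_of_thickSet charlesSchnell_algebraicityLocus_iUnion_closed_holds f hf h𝒳
      (IsQuasiProjectiveOver.of_isAffine S) ‹_› W
      {t : ComplexPoints S | complexBetti.map (fiberι f t) (2 * p) W ∈ algebraicClasses (fiberOver f t) p}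
      (curve_not_subset_iUnion_of_not_countable hdim _
        (not_countable_algebraicityLocus_of_cell hT (hSR (by omega) (by omega)) f hf h𝒳 hdim habel he (by omega) W hW hs₀))
      (fun t ht => ht) s

/-! ## §2 One cell per class, over every base with a section (Mumford's curve through the anchor and the target) -/

/-- **VHC at `(n, p)` on every abelian-fibred family with a section over a smooth irreducible base, from the door, the curve residual and the
SINGLE cell `(2m, m)`, `m = max(p, n − p)`**: join `s₀` and `s` by a smooth irreducible affine curve `g : C ⟶ S` (tree theorem
`mumford_smoothCurve_through_two_points_of_irreducibleSpace_of_smooth`), base-change (`exists_section_familyPullback`,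
`fiberOverFamilyPullbackIso`; total space quasi-projective by the residual) and run §1 on `C` (`Theorems.variationalHodge_conclusion_of_baseChange`).
[cite: MumfordAV1970, §6 Lemma] [cite: CharlesSchnell2014Notes, Prop. 11.3.11 (proof)] [cite: GortzWedhorn2023, Thm. 27.291] -/
theorem forall_mem_algebraicClasses_of_cell_of_section {𝒪 : ObjClass} (hT : LocalVariationalHodgeFor 𝒪) {n p : ℕ}
    (hSR : 2 ≤ p → p + 2 ≤ n → AdmissibleRepresentativesLefAtDeg 𝒪 (2 * max p (n - p)) (max p (n - p)))
    (hqp : OneParameterAbelianSchemeQuasiProjective) (f : 𝒳 ⟶ S) (hf : IsSmoothProjectiveFamily f n)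
    [IrreducibleSpace S.left] [AlgebraicGeometry.Smooth S.hom]
    (habel : ∀ s : ComplexPoints S, ∃ A' : AbelianVariety ℂ, A'.dim = n ∧ Nonempty (A'.X ≅ fiberOver f s))
    (he : ∃ e : S ⟶ 𝒳, e ≫ f = 𝟙 S) (W : complexBetti 𝒳 (2 * p))
    (hW : ∀ s : ComplexPoints S, IsRationalClass (complexBetti.map (fiberι f s) (2 * p) W) ∧
      IsOfHodgeType n (fiberOver f s) (2 * p) p p (complexBetti.map (fiberι f s) (2 * p) W))
    {s₀ : ComplexPoints S} (hs₀ : complexBetti.map (fiberι f s₀) (2 * p) W ∈ algebraicClasses (fiberOver f s₀) p)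
    (s : ComplexPoints S) : complexBetti.map (fiberι f s) (2 * p) W ∈ algebraicClasses (fiberOver f s) p := by
  obtain ⟨C, g, t₀, t, hCaff, hCirr, hCsm, hCdim, ht₀, ht⟩ :=
    mumford_smoothCurve_through_two_points_of_irreducibleSpace_of_smooth (S := S) s₀ s
  haveI := hCaff
  haveI := hCirr
  haveI := hCsm
  have habel' : ∀ s' : ComplexPoints C, ∃ A' : AbelianVariety ℂ, A'.dim = n ∧
      Nonempty (A'.X ≅ fiberOver (familyPullback.snd f g) s') := fun s' => by
    obtain ⟨A', hd, ⟨e⟩⟩ := habel (AlgPoints.map g s')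
    exact ⟨A', hd, ⟨e ≪≫ (fiberOverFamilyPullbackIso f g s').symm⟩⟩
  have he' := exists_section_familyPullback f g he
  refine Theorems.variationalHodge_conclusion_of_baseChange f hf g W hW ht₀ ht (fun hW' h₀' => ?_) hs₀
  exact forall_mem_algebraicClasses_oneParameter_of_cell hT hSR (familyPullback.snd f g) (hf.familyPullback_snd g)
    (hqp _ (hf.familyPullback_snd g) hCirr hCaff hCsm hCdim habel' he') hCdim habel' he' _ hW' h₀' t

/-! ## §3 Per abelian variety: Lemme 6.3.1 + `HC_CM` at dimension `2g` + the cells `g + 2 ≤ m ≤ 2g − 2` -/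

/-- **HC for ONE abelian variety `A` of dimension `g` from Lemme 6.3.1, `HC_CM` at dimension `2g`, the door, the curve residual and the
crux on the cells `(2m, m)`, `g + 2 ≤ m ≤ 2g − 2`**: codimensions `p ≤ 1`, `p ≥ g − 1` of `A` are divisorial; for `2 ≤ p ≤ g − 2` André's
pencil has relative dimension `2g` and the class codimension `p < g`, so §2 consumes the single cell `m = 2g − p`.
[cite: Andre1996Motifs, Lemme 6.3.1 (p. 31) and §6.3 a) (p. 33)] [cite: Abdulali1994FamiliesAV, Lemma 6.2 (p. 1131)] [cite: Milne1999, §7 p. 72] -/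
theorem hodgeConjectureFor_of_HC_CM_of_cmAnchoredPencil_of_cells (h₂₁ : andre1996_cmAnchoredPencil) {𝒪 : ObjClass}
    (hT : LocalVariationalHodgeFor 𝒪) (hqp : OneParameterAbelianSchemeQuasiProjective) (A : AbelianVariety ℂ)
    (hCM : ∀ A₀ : AbelianVariety ℂ, A₀.dim = 2 * A.dim → CMHodgeHypothesisAt A₀)
    (hSR : ∀ m : ℕ, A.dim + 2 ≤ m → m + 2 ≤ 2 * A.dim → AdmissibleRepresentativesLefAtDeg 𝒪 (2 * m) m) :
    HodgeConjectureFor A.dim A.X := by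
  have hA : IsSmoothProjective A.dim A.X := AbelianVariety.isSmoothProjective_holds
  refine (hodgeConjectureFor_iff_of_isSmoothProjective nonempty_hodgeModel_holds hA).2 ?_
  intro p c hc hpp
  by_cases hoff : p ≤ 1 ∨ A.dim ≤ p + 1
  · exact (mem_algebraicClasses_and_divisorClassesSpan_of_offMidRange hA hoff c hc hpp).1
  obtain ⟨𝒳, S, f, hf, s, t, W, A₁, A₀, e₁, g, q, hW, hq, hgc, ⟨e₀⟩, hA₀⟩ := h₂₁ A hA p c hc hpp
  have hA₀sp : IsSmoothProjective A₀.dim A₀.X := AbelianVariety.isSmoothProjective_holds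
  have hdim : A₀.dim = 2 * A.dim := compactPencil_dim_eq_of_iso hf e₀
  have h₀ : complexBetti.map (fiberι f t) (2 * p) W ∈ algebraicClasses (fiberOver f t) p := by
    have hHC := (hCM A₀ hdim hA₀sp hA₀).2 p
    rw [hdim] at hHC
    exact (forall_hodgeClass_mem_algebraicClasses_iff_of_iso e₀ p).1 hHC _ (hW t).1 (hW t).2
  haveI := compactPencil_irreducibleSpace_base hf
  haveI := compactPencil_smooth_base hf
  have hcell : max p (2 * A.dim - p) = 2 * A.dim - p := max_eq_right (by omega)
  have h₁ := forall_mem_algebraicClasses_of_cell_of_section hT (n := 2 * A.dim) (p := p)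
    (fun _ _ => by rw [hcell]; exact hSR (2 * A.dim - p) (by omega) (by omega)) hqp f hf.isSmoothProjectiveFamily
    (compactPencil_exists_abelianVariety_fiber_dim hf) hf.exists_section W hW h₀ s
  have h₂ : complexBetti.map e₁.hom (2 * p) (complexBetti.map (fiberι f s) (2 * p) W) ∈ algebraicClasses A₁.X p :=
    (mem_algebraicClasses_map_iff_of_iso e₁).2 h₁
  have h₃ : (q : ℂ) • c ∈ algebraicClasses A.X p := by
    rw [← hgc]
    exact map_mem_algebraicClasses_of_abelianVariety hA A₁ g.hom.hom.hom h₂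
  exact (Submodule.smul_mem_iff _ (Rat.cast_ne_zero.2 hq)).1 h₃

/-! ## §4 The rows -/

/-- **`HCAtDim g` from Lemme 6.3.1, `HC_CM` at dimension `2g`, the door, the curve residual and the cells `(2m, m)`, `g + 2 ≤ m ≤ 2g − 2`.**
For `g = 6`: `HC_CM` for 12-folds and the cells `(16,8), (18,9), (20,10)`. [cite: Andre1996Motifs, Lemme 6.3.1 (p. 31) and §6.3 a) (p. 33)]
[cite: Abdulali1994FamiliesAV, Lemma 6.2 (p. 1131)] -/
theorem hcAtDim_of_HC_CM_of_lefAtDeg_cells (g : ℕ) (h₂₁ : andre1996_cmAnchoredPencil) {𝒪 : ObjClass}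
    (hT : LocalVariationalHodgeFor 𝒪) (hqp : OneParameterAbelianSchemeQuasiProjective)
    (hCM : ∀ A₀ : AbelianVariety ℂ, A₀.dim = 2 * g → CMHodgeHypothesisAt A₀)
    (hSR : ∀ m : ℕ, g + 2 ≤ m → m + 2 ≤ 2 * g → AdmissibleRepresentativesLefAtDeg 𝒪 (2 * m) m) : HCAtDim g := by
  intro A hAg
  have hg : A.dim = g := hAg
  exact hodgeConjectureFor_of_HC_CM_of_cmAnchoredPencil_of_cells h₂₁ hT hqp A (fun A₀ h₀ => hCM A₀ (by rw [h₀, hg]))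
    fun m hm hm' => hSR m (by omega) (by omega)

/-- **`HC_AV` from `HC_CM`, Lemme 6.3.1, the door, the curve residual and the crux on the diagonal cells `(2m, m)`, `m ≥ 6` — NO
low-dimensional input, FACT-FREE beyond the displayed hypotheses** (`g ≤ 3`: `hcAtDim_of_le_three`; `g ≥ 4`: the cells `m ≥ g + 2 ≥ 6`).
[cite: Andre1996Motifs, Lemme 6.3.1 (p. 31) and §6.3 a) (p. 33)] [cite: Abdulali1994FamiliesAV, Lemma 6.2] [cite: VoisinHodgeII2003, §10.2.3 proof of Prop. 10.26] -/
theorem hc_av_of_HC_CM_of_lefAtDeg_diagonal_six (h₂₁ : andre1996_cmAnchoredPencil) {𝒪 : ObjClass}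
    (hT : LocalVariationalHodgeFor 𝒪) (hqp : OneParameterAbelianSchemeQuasiProjective) (hCM : Theses.RankFourFaces.CMAbelianHodge)
    (hSR : ∀ m : ℕ, 6 ≤ m → AdmissibleRepresentativesLefAtDeg 𝒪 (2 * m) m) :
    Theses.PadicSemiregularLift.HodgeAbelianVarieties := by
  refine hodgeAbelianVarieties_iff_forall_hcAtDim.2 fun g => ?_
  rcases Nat.lt_or_ge g 4 with hg | hg
  · exact hcAtDim_of_le_three (by omega)
  · exact hcAtDim_of_HC_CM_of_lefAtDeg_cells g h₂₁ hT hqp (fun A₀ _ => hCM A₀) fun m hm _ => hSR m (by omega)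

/-- **`HC_AV` from `HC_CM`, Lemme 6.3.1, the door, the curve residual, `HCUpToDim 5` (Markman 2025 Cor. 1.3, UNREFEREED) and the crux on
the diagonal cells `(2m, m)`, `m ≥ 8`.** [cite: Andre1996Motifs, Lemme 6.3.1 (p. 31) and §6.3 a) (p. 33)] [cite: Markman2025SurveySecant, Cor. 1.3]
[cite: Abdulali1994FamiliesAV, Lemma 6.2] -/
theorem hc_av_of_HC_CM_of_hcUpToDim_five_of_lefAtDeg_diagonal_eight (h₂₁ : andre1996_cmAnchoredPencil) {𝒪 : ObjClass}
    (hT : LocalVariationalHodgeFor 𝒪) (hqp : OneParameterAbelianSchemeQuasiProjective) (hCM : Theses.RankFourFaces.CMAbelianHodge)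
    (h₅ : HCUpToDim 5) (hSR : ∀ m : ℕ, 8 ≤ m → AdmissibleRepresentativesLefAtDeg 𝒪 (2 * m) m) :
    Theses.PadicSemiregularLift.HodgeAbelianVarieties := by
  refine hodgeAbelianVarieties_iff_forall_hcAtDim.2 fun g => ?_
  rcases Nat.lt_or_ge g 6 with hg | hg
  · exact hcAtDim_of_hcUpToDim (hcUpToDim_mono (by omega) h₅)
  · exact hcAtDim_of_HC_CM_of_lefAtDeg_cells g h₂₁ hT hqp (fun A₀ _ => hCM A₀) fun m hm _ => hSR m (by omega)

/-- **The `closes`-shape over the TWISTED door with route-decl hypotheses, `HC_CM`-load-bearing, FACT-FREE otherwise: `HC_AV` from K-C,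
`HC_CM`, the twisted door, Raynaud, Lemme 6.3.1 and regime 2 on the diagonal cells `(2m, m)`, `m ≥ 6`.**
[cite: Andre1996Motifs, Lemme 6.3.1 (p. 31)] [cite: Pridham2024Semiregularity, Cor. 2.25 and Rem. 2.27] [cite: GortzWedhorn2023, Thm. 27.291] -/
theorem hc_av_of_cmAbelianHodge_of_twAtDiag_six (hC : Theses.VHCAbelianSchemesRoad.ChernCharacterOnBetti)
    (hCM : Theses.RankFourFaces.CMAbelianHodge)
    (hDiag : ∀ (C : ChernCharacterBetti) (m : ℕ), 6 ≤ m →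
      LefAtExceptionalRegimeAt (Literature.AlgebraicGeometry.HodgeTheory.twistedReflexiveClass C
        (fun n X₀ I E => Summit.Ventures.HSemireg.gluableSigmaAdmissible n X₀ I E ∨
          Literature.AlgebraicGeometry.HodgeTheory.bfSingleAdmissible n X₀ I E)) (2 * m) m)
    (hDoor : Theses.VHCAbelianSchemesRoad.TwistedPerfectDoor) (hR : Theses.VHCAbelianSchemesRoad.RaynaudSectionProjective)
    (h₂₁ : Theses.VHCAbelianSchemesRoad.AndreCMAnchoredPencil) : Theses.PadicSemiregularLift.HodgeAbelianVarieties := by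
  obtain ⟨C⟩ := hC
  exact hc_av_of_HC_CM_of_lefAtDeg_diagonal_six h₂₁ (hDoor C) (oneParameterAbelianSchemeQuasiProjective_of_raynaud1970 hR) hCM
    fun m hm => admissibleRepresentativesLefAtDeg_twisted_of_exceptionalRegimeAt C (fun _ _ _ _ h => Or.inr h) (hDiag C m hm)

/-- **The same from `(16, 8)` on, granted the support item `Theses.SevenfoldWeilCensus.HodgeAbelianDimLeFive`** (Markman 2025 Cor. 1.3,
UNREFEREED). [cite: Andre1996Motifs, Lemme 6.3.1 (p. 31)] [cite: Markman2025SurveySecant, Cor. 1.3] [cite: Pridham2024Semiregularity, Cor. 2.25 and Rem. 2.27] -/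
theorem hc_av_of_cmAbelianHodge_of_hodgeAbelianDimLeFive_of_twAtDiag_eight (hC : Theses.VHCAbelianSchemesRoad.ChernCharacterOnBetti)
    (hCM : Theses.RankFourFaces.CMAbelianHodge) (h₅ : Theses.SevenfoldWeilCensus.HodgeAbelianDimLeFive)
    (hDiag : ∀ (C : ChernCharacterBetti) (m : ℕ), 8 ≤ m →
      LefAtExceptionalRegimeAt (Literature.AlgebraicGeometry.HodgeTheory.twistedReflexiveClass C
        (fun n X₀ I E => Summit.Ventures.HSemireg.gluableSigmaAdmissible n X₀ I E ∨
          Literature.AlgebraicGeometry.HodgeTheory.bfSingleAdmissible n X₀ I E)) (2 * m) m)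
    (hDoor : Theses.VHCAbelianSchemesRoad.TwistedPerfectDoor) (hR : Theses.VHCAbelianSchemesRoad.RaynaudSectionProjective)
    (h₂₁ : Theses.VHCAbelianSchemesRoad.AndreCMAnchoredPencil) : Theses.PadicSemiregularLift.HodgeAbelianVarieties := by
  obtain ⟨C⟩ := hC
  exact hc_av_of_HC_CM_of_hcUpToDim_five_of_lefAtDeg_diagonal_eight h₂₁ (hDoor C)
    (oneParameterAbelianSchemeQuasiProjective_of_raynaud1970 hR) hCM (hcUpToDim_five_iff_hodgeAbelianDimLeFive.2 h₅)
    fun m hm => admissibleRepresentativesLefAtDeg_twisted_of_exceptionalRegimeAt C (fun _ _ _ _ h => Or.inr h) (hDiag C m hm)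

end Summit.HodgeConjecture.HodgeConjecture.Ring2.SemiregularRepresentatives

end
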